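import Summits.ABC.ABC.Theses.CubicResolventAllowance
import Summits.ABC.ABC.Theorems.PlaceCountSzpiroDiscLeJHeight
import Summits.ABC.ABC.Theorems.CubicResolventAllowanceResolventDiscBounds
import Literature.NumberTheory.NumberFields.IntegralBasisOfFamily

/-!
# Stub ideation k=3 (family 3: probe the extremes) — helper-lemma signatures for `stub_realCubic`
of crux `IndexSzpiro` (stmt-ABC-22740), route `CubicResolventAllowance`.

Sketch only: every `theorem` below is a PROPOSED helper (`sorry`), elaborated to make sure the
signatures typecheck over existing declarations. Nothing here is a claim of proof.
-/

set_option linter.dupNamespace false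

noncomputable section

namespace Summit.ABC.ABC.Cruxes.IndexSzpiro.StubIdeas3

open IsDedekindDomain Rat.HeightOneSpectrum NumberField
open Summit.ABC.ABC.Theses.CubicResolventAllowance

/-! ## The registered stub, verbatim, as a Prop (target of the assemblies below) -/

/-- `stub_realCubic` (d_K > 0 half of `IndexSzpiro`), verbatim registered signature. -/
def StubRealCubic : Prop :=
  ∀ ε : ℝ, 0 < ε → ∃ C : ℝ, ∀ (W : WeierstrassCurve ℚ) [W.IsElliptic] (K : Type) [Field K]
    [NumberField K], Irreducible W.twoTorsionPolynomial.toPoly → Module.finrank ℚ K = 3 →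
    (∃ θ : K, Polynomial.aeval θ W.twoTorsionPolynomial.toPoly = 0) → 0 < NumberField.discr K →
    (W.minimalDiscriminantNorm ℤ : ℝ) ≤
      C * |(NumberField.discr K : ℝ)| * (W.conductorNorm ℤ : ℝ) ^ (6 + ε)

/-! ## Plan A — the allowance is the squarefree kernel of `Δ_min` (parity transfer `Δ ≡ d_K mod □`) -/

section PlanA

variable (W : WeierstrassCurve ℚ) [W.IsElliptic] (K : Type) [Field K] [NumberField K]

/-- **H1** `Δ(W) = r² · d_K` for the cubic field of the 2-division polynomial: the power basis
`1, θ, θ²` of `K = ℚ(θ)` has `disc_ℚ = disc(ψ₂/4) = 16Δ/4⁴` (Mathlib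
`WeierstrassCurve.twoTorsionPolynomial_discr`, `Cubic.discr_eq_prod_three_roots`,
`Algebra.discr_powerBasis_eq_prod''`) and any `ℚ`-basis discriminant is `(det)²·d_K`
(`Algebra.discr_of_matrix_vecMul`, tree `discr_family_eq_det_sq_mul_discr`). One prover cycle. -/
theorem Δ_eq_sq_mul_discr (hirr : Irreducible W.twoTorsionPolynomial.toPoly)
    (hdeg : Module.finrank ℚ K = 3)
    (hθ : ∃ θ : K, Polynomial.aeval θ W.twoTorsionPolynomial.toPoly = 0) :
    ∃ r : ℚ, r ≠ 0 ∧ W.Δ = r ^ 2 * (NumberField.discr K : ℚ) := by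
  sorry

/-- **H1'** minimal-model transfer: `|Δ_min| = q² · |d_K|` with `q ∈ ℚˣ` (H1 + a global minimal
model over `ℤ`, `minimalDiscriminantNorm_eq_natAbs_holds`, Mathlib `WeierstrassCurve.variableChange_Δ`
: `(C • W).Δ = u⁻¹¹² Δ`). One prover cycle. -/
theorem minimalDiscriminantNorm_eq_sq_mul_abs_discr (hirr : Irreducible W.twoTorsionPolynomial.toPoly)
    (hdeg : Module.finrank ℚ K = 3)
    (hθ : ∃ θ : K, Polynomial.aeval θ W.twoTorsionPolynomial.toPoly = 0) :
    ∃ q : ℚ, q ≠ 0 ∧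
      (W.minimalDiscriminantNorm ℤ : ℚ) = q ^ 2 * |(NumberField.discr K : ℚ)| := by
  sorry

/-- **H0** integral form: `|Δ_min| · |d_K|` is a perfect square (from H1'). -/
theorem isSquare_minimalDiscriminantNorm_mul_natAbs_discr
    (hirr : Irreducible W.twoTorsionPolynomial.toPoly) (hdeg : Module.finrank ℚ K = 3)
    (hθ : ∃ θ : K, Polynomial.aeval θ W.twoTorsionPolynomial.toPoly = 0) :
    IsSquare (W.minimalDiscriminantNorm ℤ * (NumberField.discr K).natAbs) := by
  sorry

/-- **H2** odd towers are paid by the allowance: `v_p(Δ_min)` odd ⇒ `p ∣ d_K` (every prime `p`,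
including `2`; purely algebraic — no Tate curve). From H0. -/
theorem dvd_discr_of_odd_factorization
    (hirr : Irreducible W.twoTorsionPolynomial.toPoly) (hdeg : Module.finrank ℚ K = 3)
    (hθ : ∃ θ : K, Polynomial.aeval θ W.twoTorsionPolynomial.toPoly = 0)
    (p : ℕ) (hp : p.Prime) (hodd : Odd ((W.minimalDiscriminantNorm ℤ).factorization p)) :
    (p : ℤ) ∣ NumberField.discr K := by
  sorry

/-- **H3** the squarefree kernel of `Δ_min` divides `d_K`: `|Δ_min| = m²·s`, `s` squarefree ⇒ `s ∣ d_K`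
(H2 prime by prime; Mathlib `Nat.sq_mul_squarefree_of_pos` produces `m, s`). -/
theorem squarefreePart_dvd_discr
    (hirr : Irreducible W.twoTorsionPolynomial.toPoly) (hdeg : Module.finrank ℚ K = 3)
    (hθ : ∃ θ : K, Polynomial.aeval θ W.twoTorsionPolynomial.toPoly = 0)
    (m s : ℕ) (hms : m ^ 2 * s = W.minimalDiscriminantNorm ℤ) (hs : Squarefree s) :
    (s : ℤ) ∣ NumberField.discr K := by
  sorry

/-- **Hsign** the sign hypothesis of the stub is `0 < Δ(W)` (`d_K > 0 ⟺` three real 2-torsion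
abscissae ⟺ `Δ > 0`; from H1). Shows the `d_K > 0 / d_K < 0` split carries no arithmetic. -/
theorem discr_pos_iff_Δ_pos (hirr : Irreducible W.twoTorsionPolynomial.toPoly)
    (hdeg : Module.finrank ℚ K = 3)
    (hθ : ∃ θ : K, Polynomial.aeval θ W.twoTorsionPolynomial.toPoly = 0) :
    0 < NumberField.discr K ↔ 0 < W.Δ := by
  sorry

/-- **H4** (sharpening) at an odd multiplicative place the resolvent cubic field is at most partially
ramified: `v_p(d_K) ≤ 1` (tree `ramificationIdx_divisionField_self_dvd_level_of_hasMultiplicativeReductionAt`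
with `n = 2` + `exists_ringHom_divisionField_two` + multiplicativity of `e` in towers + the tame bound
`v_p(d_K) ≤ e - 1` summed over primes above `p`). With H2: `v_p(d_K) ≡ n_p (mod 2)` — the allowance pays
EXACTLY one `p` per odd Tate tower. One–two prover cycles. -/
theorem factorization_discr_le_one_of_hasMultiplicativeReductionAt
    (hdeg : Module.finrank ℚ K = 3)
    (hθ : ∃ θ : K, Polynomial.aeval θ W.twoTorsionPolynomial.toPoly = 0)
    (v : HeightOneSpectrum ℤ) (hp2 : natGenerator v ≠ 2) (hmult : W.HasMultiplicativeReductionAt v) :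
    (NumberField.discr K).natAbs.factorization (natGenerator v) ≤ 1 := by
  sorry

end PlanA

/-- **The residual core (K-free, sign-free): Szpiro for the SQUARE PART of `Δ_min`.**
`m² ∣ Δ_min ⇒ m² ≤ C_ε · N^{6+ε}` on the irreducible-`ψ₂` class. OPEN (Szpiro-strength on its class:
it implies `Δ_min ≤ C_ε N^{7+ε}` there, since the cofactor is squarefree and divides `d_K`). -/
def SquareCore : Prop :=
  ∀ ε : ℝ, 0 < ε → ∃ C : ℝ, ∀ (W : WeierstrassCurve ℚ) [W.IsElliptic],
    Irreducible W.twoTorsionPolynomial.toPoly → ∀ m : ℕ, m ^ 2 ∣ W.minimalDiscriminantNorm ℤ →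
      ((m : ℝ) ^ 2 ≤ C * (W.conductorNorm ℤ : ℝ) ^ (6 + ε))

/-- The sign-restricted slice actually needed by `stub_realCubic`. -/
def RealSquareCore : Prop :=
  ∀ ε : ℝ, 0 < ε → ∃ C : ℝ, ∀ (W : WeierstrassCurve ℚ) [W.IsElliptic],
    Irreducible W.twoTorsionPolynomial.toPoly → 0 < W.Δ → ∀ m : ℕ,
      m ^ 2 ∣ W.minimalDiscriminantNorm ℤ → ((m : ℝ) ^ 2 ≤ C * (W.conductorNorm ℤ : ℝ) ^ (6 + ε))

theorem realSquareCore_of_squareCore (h : SquareCore) : RealSquareCore := by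
  intro ε hε
  obtain ⟨C, hC⟩ := h ε hε
  exact ⟨C, fun W _ hirr _ m hm => hC W hirr m hm⟩

/-- **Assembly A**: core ⇒ stub, constant unchanged (`Δ_min = m² s ≤ (C N^{6+ε}) · s ≤ C N^{6+ε} |d_K|`
by H3 and `s ∣ d_K`, `d_K ≠ 0`). One prover cycle (arithmetic only). -/
theorem stubRealCubic_of_realSquareCore (h : RealSquareCore) : StubRealCubic := by
  intro ε hε
  obtain ⟨C, hC⟩ := h ε hε
  refine ⟨C, ?_⟩
  intro W _ K _ _ hirr hdeg hθ hpos
  have hΔpos : 0 < W.Δ := (discr_pos_iff_Δ_pos W K hirr hdeg hθ).mp hpos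
  obtain ⟨s, m, -, -, hms, hs⟩ :=
    Nat.sq_mul_squarefree_of_pos (WeierstrassCurve.minimalDiscriminantNorm_pos_holds W)
  have hsd : (s : ℤ) ∣ NumberField.discr K := squarefreePart_dvd_discr W K hirr hdeg hθ m s hms hs
  have hd0 : NumberField.discr K ≠ 0 := NumberField.discr_ne_zero K
  have hsle : (s : ℝ) ≤ |(NumberField.discr K : ℝ)| := by
    have h1 : (s : ℤ) ≤ |NumberField.discr K| :=
      Int.le_of_dvd (abs_pos.mpr hd0) ((dvd_abs _ _).mpr hsd)
    have h2 : ((s : ℤ) : ℝ) ≤ ((|NumberField.discr K| : ℤ) : ℝ) := by exact_mod_cast h1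
    simpa [Int.cast_abs] using h2
  have hm : (m : ℝ) ^ 2 ≤ C * (W.conductorNorm ℤ : ℝ) ^ (6 + ε) := hC W hirr hΔpos m ⟨s, hms.symm⟩
  have hCN : 0 ≤ C * (W.conductorNorm ℤ : ℝ) ^ (6 + ε) := le_trans (by positivity) hm
  have hcast : (W.minimalDiscriminantNorm ℤ : ℝ) = (m : ℝ) ^ 2 * (s : ℝ) := by
    rw [← hms]; push_cast; ring
  rw [hcast]
  calc (m : ℝ) ^ 2 * (s : ℝ) ≤ (C * (W.conductorNorm ℤ : ℝ) ^ (6 + ε)) * (s : ℝ) :=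
        mul_le_mul_of_nonneg_right hm (Nat.cast_nonneg _)
    _ ≤ (C * (W.conductorNorm ℤ : ℝ) ^ (6 + ε)) * |(NumberField.discr K : ℝ)| :=
        mul_le_mul_of_nonneg_left hsle hCN
    _ = C * |(NumberField.discr K : ℝ)| * (W.conductorNorm ℤ : ℝ) ^ (6 + ε) := by ring

/-- Both signs at once: core ⇒ the crux itself. -/
theorem indexSzpiro_of_squareCore (h : SquareCore) : IndexSzpiro := by
  intro ε hε
  obtain ⟨C, hC⟩ := h ε hε
  refine ⟨C, ?_⟩
  intro W _ K _ _ hirr hdeg hθ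
  obtain ⟨s, m, -, -, hms, hs⟩ :=
    Nat.sq_mul_squarefree_of_pos (WeierstrassCurve.minimalDiscriminantNorm_pos_holds W)
  have hsd : (s : ℤ) ∣ NumberField.discr K := squarefreePart_dvd_discr W K hirr hdeg hθ m s hms hs
  have hd0 : NumberField.discr K ≠ 0 := NumberField.discr_ne_zero K
  have hsle : (s : ℝ) ≤ |(NumberField.discr K : ℝ)| := by
    have h1 : (s : ℤ) ≤ |NumberField.discr K| :=
      Int.le_of_dvd (abs_pos.mpr hd0) ((dvd_abs _ _).mpr hsd)
    have h2 : ((s : ℤ) : ℝ) ≤ ((|NumberField.discr K| : ℤ) : ℝ) := by exact_mod_cast h1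
    simpa [Int.cast_abs] using h2
  have hm : (m : ℝ) ^ 2 ≤ C * (W.conductorNorm ℤ : ℝ) ^ (6 + ε) := hC W hirr m ⟨s, hms.symm⟩
  have hCN : 0 ≤ C * (W.conductorNorm ℤ : ℝ) ^ (6 + ε) := le_trans (by positivity) hm
  have hcast : (W.minimalDiscriminantNorm ℤ : ℝ) = (m : ℝ) ^ 2 * (s : ℝ) := by
    rw [← hms]; push_cast; ring
  rw [hcast]
  calc (m : ℝ) ^ 2 * (s : ℝ) ≤ (C * (W.conductorNorm ℤ : ℝ) ^ (6 + ε)) * (s : ℝ) :=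
        mul_le_mul_of_nonneg_right hm (Nat.cast_nonneg _)
    _ ≤ (C * (W.conductorNorm ℤ : ℝ) ^ (6 + ε)) * |(NumberField.discr K : ℝ)| :=
        mul_le_mul_of_nonneg_left hsle hCN
    _ = C * |(NumberField.discr K : ℝ)| * (W.conductorNorm ℤ : ℝ) ^ (6 + ε) := by ring

/-! ### Rung A — the bounded-pole regime: ε-free `IndexSzpiro` with constant 64 where Szpiro(6) is open -/

section RungA

variable (W : WeierstrassCurve ℚ) [W.IsElliptic] (v : HeightOneSpectrum ℤ)

/-- Local rung, odd places: if the pole of `j` at `p` has order `≤ 7` then the EVEN part of the tower is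
paid by `6 f_v` (cases: multiplicative `e ≤ 7`; additive `f ≥ 2` and `e ≤ f + 8` / `e ≤ δ + 6 ≤ 13`;
tree `DiscLeJHeight.ordMinimalDiscriminant_le_den_of_hasMultiplicativeReductionAt`,
`two_le_conductorExponent_of_not_hasMultiplicativeReductionAt`,
`ordMinimalDiscriminant_le_conductorExponent_add_eight`, `ordMinimalDiscriminant_le_den_add_six`). -/
theorem two_mul_ordMinimalDiscriminant_div_two_le (hp2 : natGenerator v ≠ 2)
    (hδ : (W.j).den.factorization (natGenerator v) ≤ 7) :
    2 * (W.ordMinimalDiscriminant v / 2) ≤ 6 * W.conductorExponent v := by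
  sorry

/-- Local rung at `2` (`e ≤ 18` potentially good, `e ≤ δ + 3 f` potentially multiplicative). -/
theorem two_mul_ordMinimalDiscriminant_div_two_le_two (hv : natGenerator v = 2)
    (hδ : (W.j).den.factorization 2 ≤ 7) :
    2 * (W.ordMinimalDiscriminant v / 2) ≤ 6 * W.conductorExponent v + 6 := by
  sorry

/-- Global rung: on `{E : every pole of j_E has order ≤ 7}` the square part of `Δ_min` is `≤ 64 N⁶`
(sum the local rungs with `factorization_minimalDiscriminantNorm_holds` / `factorization_conductorNorm_holds`,
as in `minimalDiscriminantNorm_dvd_den_j_mul`). -/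
theorem sq_le_of_sq_dvd_minimalDiscriminantNorm_of_poles_le_seven
    (hδ : ∀ p : ℕ, (W.j).den.factorization p ≤ 7) (m : ℕ) (hm : m ^ 2 ∣ W.minimalDiscriminantNorm ℤ) :
    m ^ 2 ≤ 2 ^ 6 * W.conductorNorm ℤ ^ 6 := by
  sorry

/-- **Rung A (BC5-type witness for the crux)**: ε-free `IndexSzpiro`, constant `64`, on the bounded-pole
class — a regime where `Δ_min ≤ C N^{6+ε}` is NOT known (towers `p⁷ ∥ Δ_min` at multiplicative `p`
exceed `6 f_p = 6`; the allowance `s ∣ d_K` pays exactly the odd excess). -/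
theorem indexSzpiro_rung (K : Type) [Field K] [NumberField K]
    (hirr : Irreducible W.twoTorsionPolynomial.toPoly) (hdeg : Module.finrank ℚ K = 3)
    (hθ : ∃ θ : K, Polynomial.aeval θ W.twoTorsionPolynomial.toPoly = 0)
    (hδ : ∀ p : ℕ, (W.j).den.factorization p ≤ 7) :
    (W.minimalDiscriminantNorm ℤ : ℝ) ≤ 2 ^ 6 * |(NumberField.discr K : ℝ)| * (W.conductorNorm ℤ : ℝ) ^ 6 := by
  sorry

end RungA

/-! ## Plan B — the allowance-free extreme: the `A₃` (square-discriminant) class -/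

section PlanB

variable (W : WeierstrassCurve ℚ) [W.IsElliptic] (K : Type) [Field K] [NumberField K]

/-- **PB1** `d_K` is a square ⟺ `Δ_min` is a perfect square (given `d_K > 0`; from H1'). -/
theorem isSquare_discr_iff_isSquare_minimalDiscriminantNorm
    (hirr : Irreducible W.twoTorsionPolynomial.toPoly) (hdeg : Module.finrank ℚ K = 3)
    (hθ : ∃ θ : K, Polynomial.aeval θ W.twoTorsionPolynomial.toPoly = 0)
    (hpos : 0 < NumberField.discr K) :
    IsSquare (NumberField.discr K) ↔ IsSquare (W.minimalDiscriminantNorm ℤ) := by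
  sorry

/-- **PB2** … ⟺ `j − 1728 ∈ ℚ²` when `c₆ ≠ 0` (`j − 1728 = c₆²/Δ`; Mathlib `WeierstrassCurve.j`,
`WeierstrassCurve.c₄`, `c₆`, `1728 Δ = c₄³ − c₆²`). Parametrises the class for the falsifier search. -/
theorem isSquare_discr_iff_isSquare_j_sub (hirr : Irreducible W.twoTorsionPolynomial.toPoly)
    (hdeg : Module.finrank ℚ K = 3)
    (hθ : ∃ θ : K, Polynomial.aeval θ W.twoTorsionPolynomial.toPoly = 0) (h6 : W.c₆ ≠ 0) :
    IsSquare (NumberField.discr K) ↔ IsSquare (W.j - 1728) := by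
  sorry

/-- **PB3** in the `A₃` class the allowance is `d_K = f_K²` with `f_K ∣ 9·rad(N_add)`: a prime `p ≥ 5`
with `p² ∣ d_K` (totally ramified) is additive, `p² ∣ N` (inertia of order 3 on `E[2]` is impossible at
a multiplicative place — Tate curve; tree `exists_ringHom_divisionField_two` + local Galois structure).
One–two prover cycles; needs a Tate-curve `E[2]` input not yet in the tree (presearch: none). -/
theorem sq_dvd_conductorNorm_of_sq_dvd_discr
    (hirr : Irreducible W.twoTorsionPolynomial.toPoly) (hdeg : Module.finrank ℚ K = 3)
    (hθ : ∃ θ : K, Polynomial.aeval θ W.twoTorsionPolynomial.toPoly = 0)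
    (p : ℕ) (hp : p.Prime) (h5 : 5 ≤ p) (hp2 : (p : ℤ) ^ 2 ∣ NumberField.discr K) :
    p ^ 2 ∣ W.conductorNorm ℤ := by
  sorry

/-- The `A₃` sub-stub (square `d_K`; allowance `= f_K² ≤ 81 rad(N_add)²`: this is plain Szpiro(6+ε) on
the class, up to the additive radical — the route's lever is EMPTY here). -/
def StubRealCubicCyclic : Prop :=
  ∀ ε : ℝ, 0 < ε → ∃ C : ℝ, ∀ (W : WeierstrassCurve ℚ) [W.IsElliptic] (K : Type) [Field K]
    [NumberField K], Irreducible W.twoTorsionPolynomial.toPoly → Module.finrank ℚ K = 3 →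
    (∃ θ : K, Polynomial.aeval θ W.twoTorsionPolynomial.toPoly = 0) →
    IsSquare (NumberField.discr K) →
    (W.minimalDiscriminantNorm ℤ : ℝ) ≤
      C * |(NumberField.discr K : ℝ)| * (W.conductorNorm ℤ : ℝ) ^ (6 + ε)

/-- The generic (`S₃`, `d_K > 0` non-square) sub-stub: here `Δ_min` is NOT a square, so at least one
tower is odd and paid by the allowance. -/
def StubRealCubicGeneric : Prop :=
  ∀ ε : ℝ, 0 < ε → ∃ C : ℝ, ∀ (W : WeierstrassCurve ℚ) [W.IsElliptic] (K : Type) [Field K]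
    [NumberField K], Irreducible W.twoTorsionPolynomial.toPoly → Module.finrank ℚ K = 3 →
    (∃ θ : K, Polynomial.aeval θ W.twoTorsionPolynomial.toPoly = 0) →
    ¬ IsSquare (NumberField.discr K) → 0 < NumberField.discr K →
    (W.minimalDiscriminantNorm ℤ : ℝ) ≤
      C * |(NumberField.discr K : ℝ)| * (W.conductorNorm ℤ : ℝ) ^ (6 + ε)

/-- **Assembly B** (pure logic, proved here): the two regimes give the stub. -/
theorem stubRealCubic_of_cyclic_of_generic (hc : StubRealCubicCyclic) (hg : StubRealCubicGeneric) :
    StubRealCubic := by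
  intro ε hε
  obtain ⟨C₁, h₁⟩ := hc ε hε
  obtain ⟨C₂, h₂⟩ := hg ε hε
  refine ⟨max C₁ C₂, ?_⟩
  intro W _ K _ _ hirr hdeg hθ hpos
  have hN : (0 : ℝ) ≤ (W.conductorNorm ℤ : ℝ) ^ (6 + ε) := Real.rpow_nonneg (Nat.cast_nonneg _) _
  by_cases hsq : IsSquare (NumberField.discr K)
  · exact (h₁ W K hirr hdeg hθ hsq).trans
      (mul_le_mul_of_nonneg_right (mul_le_mul_of_nonneg_right (le_max_left _ _) (abs_nonneg _)) hN)
  · exact (h₂ W K hirr hdeg hθ hsq hpos).trans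
      (mul_le_mul_of_nonneg_right (mul_le_mul_of_nonneg_right (le_max_right _ _) (abs_nonneg _)) hN)

/-- Plain Szpiro(6+ε) on the `A₃` class implies the cyclic sub-stub (`|d_K| ≥ 1`). Recorded to make the
honesty point checkable: nothing weaker than class-restricted Szpiro is on offer for this regime. -/
def CyclicClassSzpiro : Prop :=
  ∀ ε : ℝ, 0 < ε → ∃ C : ℝ, ∀ (W : WeierstrassCurve ℚ) [W.IsElliptic],
    Irreducible W.twoTorsionPolynomial.toPoly → IsSquare (W.minimalDiscriminantNorm ℤ) → 0 < W.Δ →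
      (W.minimalDiscriminantNorm ℤ : ℝ) ≤ C * (W.conductorNorm ℤ : ℝ) ^ (6 + ε)

theorem stubRealCubicCyclic_of_cyclicClassSzpiro (h : CyclicClassSzpiro) : StubRealCubicCyclic := by
  sorry

end PlanB

/-! ## Plan C — where a minimal counterexample must live: the deep-`j`-pole (Tate tower) regime -/

section PlanC

variable (W : WeierstrassCurve ℚ) [W.IsElliptic]

open Summit.ABC.ABC.Theorems in
/-- **PC1** square divisors of `Δ_min` are paid by the pole of `j`: `m² ∣ Δ_min ⇒ m² ≤ 2⁸·den(j)·N⁵`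
(tree `minimalDiscriminantNorm_dvd_den_j_mul`). Hence a violation `m² > C N^{6+ε}` of `SquareCore`
forces `den(j_E) > (C/2⁸)·N^{1+ε}`: counterexamples have fat multiplicative / potentially-multiplicative
towers and nothing else matters. Proved here. -/
theorem sq_le_den_j_mul (m : ℕ) (hm : m ^ 2 ∣ W.minimalDiscriminantNorm ℤ) :
    m ^ 2 ≤ 2 ^ 8 * (W.j).den * W.conductorNorm ℤ ^ 5 := by
  have h := hm.trans (minimalDiscriminantNorm_dvd_den_j_mul W)
  refine Nat.le_of_dvd (Nat.pos_of_ne_zero ?_) h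
  exact mul_ne_zero (mul_ne_zero (by norm_num) (W.j).den_pos.ne')
    (pow_ne_zero 5 (WeierstrassCurve.conductorNorm_pos_holds W).ne')

/-- **PC2** semistable dictionary: for squarefree `N`, `|Δ_min| = den(j)` (every bad place is
multiplicative and `v_p(j) = -v_p(Δ_min)`; tree
`valuation_j_eq_exp_ordMinimalDiscriminant_of_hasMultiplicativeReductionAt`,
`conductorExponent_eq_one_iff_holds`, `factorization_conductorNorm_holds`). One prover cycle. -/
theorem minimalDiscriminantNorm_eq_den_j_of_squarefree (hN : Squarefree (W.conductorNorm ℤ)) :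
    W.minimalDiscriminantNorm ℤ = (W.j).den := by
  sorry

/-- **PC3** the semistable slice of the core in Tate-parameter language (`K`-free, sign-free, `j`-only):
"square part of `den(j_E)` is `≤ C_ε N^{6+ε}`" for semistable `E` with irreducible `ψ₂`. Shared territory
with route SingleTowerSzpiro's `stub_multiplicativeTower` (stmt-ABC-22410). OPEN. -/
def SemistableSquareCore : Prop :=
  ∀ ε : ℝ, 0 < ε → ∃ C : ℝ, ∀ (W : WeierstrassCurve ℚ) [W.IsElliptic],
    Irreducible W.twoTorsionPolynomial.toPoly → Squarefree (W.conductorNorm ℤ) → ∀ m : ℕ,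
      m ^ 2 ∣ (W.j).den → ((m : ℝ) ^ 2 ≤ C * (W.conductorNorm ℤ : ℝ) ^ (6 + ε))

/-- `SquareCore ⇒ SemistableSquareCore` (via PC2); the converse is the additive-tower bookkeeping of
Rung A (potentially multiplicative `Iₙ*` towers carry `δ_p + 6`). -/
theorem semistableSquareCore_of_squareCore (h : SquareCore) : SemistableSquareCore := by
  intro ε hε
  obtain ⟨C, hC⟩ := h ε hε
  refine ⟨C, fun W _ hirr hN m hm => hC W hirr m ?_⟩
  rwa [minimalDiscriminantNorm_eq_den_j_of_squarefree W hN]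

/-- **PC4** converse on semistable curves: the crux restricted to squarefree `N` IS `SemistableSquareCore`
(H4 at odd places, the cap `v_2(d_K) ≤ 3` of `CubicResolventAllowanceResolventDiscBoundsCaps`, so the
"totally ramified" cofactor `|d_K| / sqf(Δ_min)` divides `8`). One prover cycle after H3, H4, PC2. -/
theorem semistableSquareCore_of_indexSzpiro (h : IndexSzpiro) : SemistableSquareCore := by
  sorry

end PlanC

end Summit.ABC.ABC.Cruxes.IndexSzpiro.StubIdeas3

end
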